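import Mathlib
import Literature.Computability.Complexity.KarpCliqueNP
import Literature.Computability.Complexity.CliqueTestGraphs
import Literature.Computability.Complexity.CircuitClassesProofs
import Literature.Computability.Complexity.CircuitClassesUniformProofs
import Literature.Computability.Complexity.CookBridges
import Literature.Computability.Complexity.TM2PassThrough
import Literature.Computability.Complexity.TM2Iterate
import Literature.Computability.Complexity.GrowthBounds
import Summits.PneNP.Statement
import HarnessLib

/-!
# PneNP / ConvexRankGates — `CliqueBridge` (stmt-PneNP-10683) by its term, without importing the
route file; uniform polynomial circuits for `CLIQUE(m, k)`, `k ≤ m`, from `NP ⊆ P/poly`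

Route `PneNP/ConvexRankGates`. The support item `CliqueBridge` says: if for some `δ ∈ (0, 1/2)`
the clique functions `CLIQUE(m, ⌈m^δ⌉₊)` of the `m(m-1)/2` edge indicators have, for every `c` and
all large `m`, no `B₂`-circuit with `≤ m^c` gates, then `P ≠ NP` (the summit statement `PneNP`).

Proof (Karp 1972; Arora–Barak 2009, Thm. 6.6, read backwards). Suppose `¬ PneNP`, i.e. every
language of `NP Bool` (Cook's classes, `PNPWave0`) lies in `P Bool`; along the PROVED model bridges
`p_bool_eq : PNPWave0.P Bool = Classes.P`, `CookBridges.np_bool_eq : PNPWave0.NP Bool = NP`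
(conjecture-free module `CookBridges`) and `P_subset_PPoly_holds : P ⊆ P/poly` this gives
`NP ⊆ P/poly`, hence `CLIQUE ∈ P/poly` (`CLIQUE_mem_NP`, Karp): polynomial-size `B₂`-circuits
deciding the codes `⟨⟨⟨m⟩, adj(G)⟩, ⟨k⟩⟩` (`encodingGraph.pairBool encodingNatBool`). For fixed
`(m, k)` the code of the instance `(⟨m, G_x⟩, k)`, `G_x = cliqueGraph x` the graph of the edge vector
`x`, is a FIXED list of positions each holding a constant or an edge bit `x_e`
(`clique_code_eq_map`: a descriptor list `ds : List (Bool ⊕ E(K_m))` with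
`code x = ds.map (Sum.elim id x)`), of length `≤ 2m² + 4m + k + 11`; wiring that layer (no gates
for the edge bits, one arity-0 gate per constant) in front of the `P/poly` circuit at that length
gives a `B₂`-circuit for `cliqueFn m k` with `≤ m^{c₁}` gates for all large `m`, uniformly in
`k ≤ m` (`exists_circuit_cliqueFn_of_NP_subset_PPoly`). At `k = ⌈m^δ⌉₊ ≤ m` this contradicts
the hypothesis at exponent `c₁`.

`cliqueBridge_term_proof` states the item's TERM verbatim (the clique function written inline, as
in the route file) instead of the route decl, and this module does NOT import the route file
`Summits.PneNP.PneNP.Theses.ConvexRankGates` (nor any module importing it): it is the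
import-cycle-free anchor asked for in the prover briefing on stmt-PneNP-13895 — the gate can link it
into the route file as `CliqueBridge_holds` without a self-import (the type is reducibly
definitionally equal to the body of `CliqueBridge`; `example : CliqueBridge := cliqueBridge_term_proof`
elaborates). The item itself was closed by `cliqueBridge_proof`
(`Theorems/ConvexRankGatesCliqueBridge.lean`, which imports the route file); the two proofs are
independent (this one goes through the `CktSize` straight-line-program calculus and is uniform in
`k ≤ m`, see `exists_circuit_cliqueFn_of_NP_subset_PPoly`, reusable for any `k(m) ≤ m`).

References: R. M. Karp, *Reducibility among combinatorial problems* (1972), §4 (CLIQUE ∈ NP);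
S. Arora, B. Barak, *Computational Complexity: A Modern Approach* (2009), §6.1 (P ⊆ P/poly,
Thm. 6.6) and Def. 6.5.
-/

namespace Summit.PneNP.PneNP.Theorems

open Filter Literature.Computability.Complexity _root_.Computability
open Literature.Computability.AlgebraicComplexity (IsPBounded)

/-! ### The code of a CLIQUE instance is a layer of constants and edge bits -/

/-- Doubling every entry of a list doubles its length. [folklore] -/
theorem length_flatMap_pair {α : Type*} (l : List α) :
    (l.flatMap fun d => [d, d]).length = 2 * l.length := by
  induction l with
  | nil => simp
  | cons a l ih => simp [List.flatMap_cons, ih]; omega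

/-- Mapping commutes with doubling every entry. [folklore] -/
theorem map_flatMap_pair {α β : Type*} (f : α → β) (l : List α) :
    (l.flatMap fun d => [d, d]).map f = (l.map f).flatMap fun d => [d, d] := by
  induction l with
  | nil => simp
  | cons a l ih => simp [List.flatMap_cons, ih]

/-- The adjacency bits of the graph `G_x` of an edge vector `x` (the tree's graph code
`encodingGraphFin`, row-major): position `(i, j)` holds the constant `0` on the diagonal and the
edge bit `x_{ij}` off it. [AroraBarak2009, §0.1 (adjacency-matrix representation)] -/
theorem encodingGraphFin_encode_cliqueGraph (m : ℕ) (x : (⊤ : SimpleGraph (Fin m)).edgeSet → Bool) :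
    (encodingGraphFin m).encode (cliqueGraph x) =
      (List.ofFn fun k : Fin (m * m) =>
        if h : (finProdFinEquiv.symm k).1 = (finProdFinEquiv.symm k).2 then (Sum.inl false : Bool ⊕ (⊤ : SimpleGraph (Fin m)).edgeSet)
        else Sum.inr ⟨s((finProdFinEquiv.symm k).1, (finProdFinEquiv.symm k).2), by simpa using h⟩).map
        (Sum.elim id x) := by
  rw [List.map_ofFn]
  unfold encodingGraphFin encodingBitVec
  simp only
  congr 1
  funext k
  simp only [Function.comp_apply]
  by_cases h : (finProdFinEquiv.symm k).1 = (finProdFinEquiv.symm k).2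
  · rw [dif_pos h, Sum.elim_inl, id, h]
    exact @decide_eq_false _ (_) (SimpleGraph.irrefl _)
  · rw [dif_neg h, Sum.elim_inr, Bool.eq_iff_iff, @decide_eq_true_iff _ (_), cliqueGraph_adj]
    constructor
    · rintro ⟨_, hx⟩
      exact hx
    · intro hx
      exact ⟨h, hx⟩

/-- **The CLIQUE instance code of an edge vector is a fixed layer.** For fixed `(m, k)` there is a
list of descriptors `ds` (a constant bit, or an edge of `K_m`), of length `≤ 2m² + 4m + k + 11`,
such that the code of the instance `(⟨m, G_x⟩, k)` under `encodingGraph.pairBool encodingNatBool`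
(`⟨⟨⟨m⟩₂, adjacency bits⟩, ⟨k⟩₂⟩`, pairing = doubled bits + separator `01`) is `ds` with every
edge descriptor replaced by the corresponding bit of `x`. [AroraBarak2009, §0.1; Karp1972, §3] -/
theorem clique_code_eq_map (m k : ℕ) :
    ∃ ds : List (Bool ⊕ (⊤ : SimpleGraph (Fin m)).edgeSet), ds.length ≤ 2 * (m * m) + 4 * m + k + 11 ∧
      ∀ x : (⊤ : SimpleGraph (Fin m)).edgeSet → Bool,
        (encodingGraph.pairBool encodingNatBool).encode (⟨m, cliqueGraph x⟩, k) =
          ds.map (Sum.elim id x) := by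
  set adj : List (Bool ⊕ (⊤ : SimpleGraph (Fin m)).edgeSet) := List.ofFn fun k : Fin (m * m) =>
    if h : (finProdFinEquiv.symm k).1 = (finProdFinEquiv.symm k).2 then (Sum.inl false : Bool ⊕ (⊤ : SimpleGraph (Fin m)).edgeSet)
    else Sum.inr ⟨s((finProdFinEquiv.symm k).1, (finProdFinEquiv.symm k).2), by simpa using h⟩ with hadj
  refine ⟨((((encodeNat m).map Sum.inl).flatMap fun d => [d, d]) ++ [Sum.inl false, Sum.inl true] ++ adj).flatMap
      (fun d => [d, d]) ++ [Sum.inl false, Sum.inl true] ++ (encodeNat k).map Sum.inl, ?_, fun x => ?_⟩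
  · have hm := TM2Pass.length_encodeNat_le_self m
    have hk := TM2Pass.length_encodeNat_le_self k
    have hadjl : adj.length = m * m := by simp [hadj]
    simp only [List.length_append, length_flatMap_pair, List.length_map, List.length_cons,
      List.length_nil, hadjl]
    omega
  · show boolPair (boolPair (encodeNat m) ((encodingGraphFin m).encode (cliqueGraph x))) (encodeNat k) = _
    rw [encodingGraphFin_encode_cliqueGraph, ← hadj]
    have hinl : ∀ l : List Bool, (l.map (Sum.inl : Bool → Bool ⊕ (⊤ : SimpleGraph (Fin m)).edgeSet)).map
        (Sum.elim id x) = l := fun l => by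
      rw [List.map_map, Sum.elim_comp_inl, List.map_id]
    simp only [boolPair, List.map_append, map_flatMap_pair, hinl, List.map_cons, List.map_nil,
      Sum.elim_inl, id]

/-- **Wiring a layer.** Reading off a descriptor list costs at most one gate per position over
`B₂`: an arity-`0` constant gate for a constant descriptor, a bare input wire for an edge
descriptor. [Vollmer1999, §1.1–1.2] -/
theorem cktSize_map_elim {ι : Type} (ds : List (Bool ⊕ ι)) :
    CktSize B2 (fun (x : ι → Bool) (i : Fin ds.length) => Sum.elim id x ds[i]) ds.length := by
  have h := CktSize.pi_const (B := B2) (κ := Fin ds.length) (s := 1)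
    (f := fun (x : ι → Bool) (i : Fin ds.length) => Sum.elim id x ds[i]) fun i => ?_
  · simpa using h
  · rcases hi : ds[i] with b | e
    · exact (cktSize_const ι b).congr fun x _ => by simp
    · exact ((CktSize.proj B2 fun _ : Unit => e).of_le (Nat.zero_le 1)).congr fun x _ => by simp

/-! ### From `NP ⊆ P/poly` to polynomial circuits for the clique functions, uniformly in `k` -/

/-- **Polynomial `B₂`-circuits for `CLIQUE(m, k)` from `NP ⊆ P/poly`**, uniformly in `k ≤ m`:
there is `c₁` such that for all large `m` and every `k ≤ m` the clique function `cliqueFn m k` of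
the edge indicators has a `B₂`-circuit with at most `m^{c₁}` gates — the `P/poly` circuit for
`CLIQUE` (`CLIQUE_mem_NP`) at the code length of `(⟨m, G⟩, k)` behind the input layer of
`clique_code_eq_map`. [Karp1972, §4; AroraBarak2009, Def. 6.5 and Thm. 6.6] -/
theorem exists_circuit_cliqueFn_of_NP_subset_PPoly (hNP : Nondeterministic.NP ⊆ PPoly) :
    ∃ c₁ : ℕ, ∀ᶠ m : ℕ in atTop, ∀ k, k ≤ m →
      ∃ C : Circuit ((⊤ : SimpleGraph (Fin m)).edgeSet), C.IsOver B2 ∧ C.size ≤ m ^ c₁ ∧ C.Computes (cliqueFn m k) := by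
  obtain ⟨p, hp⟩ := Set.mem_iUnion.1 (hNP CLIQUE_mem_NP)
  obtain ⟨C, hC, hDec⟩ := hp
  set q : ℕ → ℕ := fun m => 2 * (m * m) + 5 * m + 11 with hq
  have hpP : IsPBounded fun N => p.eval N :=
    (Literature.Computability.AlgebraicComplexity.isPBounded_iff_exists_polynomial_holds _).2 ⟨p, fun _ => le_rfl⟩
  have hqP : IsPBounded q :=
    IsPBounded.add_holds (IsPBounded.add_holds
      (IsPBounded.mul_holds (IsPBounded.const 2) (IsPBounded.mul_holds IsPBounded.id IsPBounded.id))
      (IsPBounded.mul_holds (IsPBounded.const 5) IsPBounded.id)) (IsPBounded.const 11)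
  have hg : IsPBounded fun m => q m + p.eval (q m) :=
    IsPBounded.add_holds hqP (IsPBounded.comp_holds hpP hqP)
  obtain ⟨K, hK⟩ := hg.eventually_lt_pow
  refine ⟨K, hK.mono fun m hm k hkm => ?_⟩
  obtain ⟨ds, hlen, hcode⟩ := clique_code_eq_map m k
  have hL : ds.length ≤ q m := by
    simp only [hq]
    omega
  have h1 := (cktSize_map_elim ds).comp ((C ds.length).cktSize_eval (hC ds.length).1)
  have h2 : CktSize B2 (fun (x : (⊤ : SimpleGraph (Fin m)).edgeSet → Bool) (_ : Unit) => cliqueFn m k x) (m ^ K) := by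
    refine (h1.of_le ?_).congr fun x _ => ?_
    · calc ds.length + (C ds.length).size ≤ ds.length + p.eval ds.length :=
            Nat.add_le_add_left (hC _).2 _
        _ ≤ q m + p.eval (q m) := Nat.add_le_add hL (TM2Iter.eval_mono p hL)
        _ ≤ m ^ K := hm.le
    · show (C ds.length).eval (fun i => Sum.elim id x ds[i]) = cliqueFn m k x
      rw [hDec.eval_eq]
      have hofFn : List.ofFn (fun i : Fin ds.length => Sum.elim id x ds[i]) = ds.map (Sum.elim id x) := by
        apply List.ext_getElem <;> simp
      rw [hofFn, ← hcode x]
      unfold Set.boolIndicator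
      split_ifs with hmem
      · have h' : ((⟨m, cliqueGraph x⟩, k) : (Σ n, SimpleGraph (Fin n)) × ℕ) ∈ cliqueSet :=
          (Encoding.mem_toLanguage_iff _ cliqueSet _).1 hmem
        exact ((cliqueFn_eq_true_iff _ _).2 h').symm
      · have h' : ((⟨m, cliqueGraph x⟩, k) : (Σ n, SimpleGraph (Fin n)) × ℕ) ∉ cliqueSet := fun h =>
          hmem ((Encoding.mem_toLanguage_iff _ cliqueSet _).2 h)
        exact ((cliqueFn_eq_false_iff _ _).2 (not_not.1 h')).symm
  obtain ⟨C', hB, hs, hev⟩ := h2.toCircuit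
  exact ⟨C', hB, hs, fun x => hev x⟩

/-! ### The bridge -/

section Bridge

-- the `open`s of the route file `Summits/PneNP/PneNP/Theses/ConvexRankGates.lean`, so that the
-- statement of `cliqueBridge_term_proof` elaborates to the route's term `CliqueBridge` on the nose
open scoped BigOperators Topology Manifold Classical MeasureTheory ProbabilityTheory Matrix InnerProductSpace ComplexConjugate ContinuousMap
open Filter Set Function TopologicalSpace MeasureTheory


/-- **`NP ⊆ P/poly` from `¬ PneNP`**, along the proved model bridges (`p_bool_eq`,
`CookBridges.np_bool_eq`) and `P ⊆ P/poly` (`P_subset_PPoly_holds`).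
[AroraBarak2009, Thm. 6.6; CookClay2006, §1] -/
theorem NP_subset_PPoly_of_not_pneNP (hne : ¬ PneNP) : Nondeterministic.NP ⊆ PPoly := by
  intro L hL
  have hP : PNPWave0.P Bool = Classes.P := p_bool_eq
  have hN : PNPWave0.NP Bool = Nondeterministic.NP := CookBridges.np_bool_eq
  have hLP : L ∈ PNPWave0.P Bool := by
    by_contra hL'
    exact hne ⟨L, hN ▸ hL, hL'⟩
  exact P_subset_PPoly_holds (hP ▸ hLP)

/-- **`CliqueBridge`** (route `ConvexRankGates`, item stmt-PneNP-10683; the term verbatim): if for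
some `δ ∈ (0, 1/2)` the clique functions `CLIQUE(m, ⌈m^δ⌉₊)` (written inline; `rfl`-equal to
`cliqueFn m ⌈m^δ⌉₊`) have, for every `c` and all large `m`, no `B₂`-circuit with `≤ m^c` gates,
then `PneNP`. From `¬ PneNP` get `NP ⊆ P/poly` (`NP_subset_PPoly_of_not_pneNP`), then polynomial
circuits for `cliqueFn m k`, `k ≤ m`, eventually (`exists_circuit_cliqueFn_of_NP_subset_PPoly`),
contradicting the hypothesis at `k = ⌈m^δ⌉₊ ≤ m`. [Karp1972, §4; AroraBarak2009, Thm. 6.6] -/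
theorem cliqueBridge_term_proof :
    (∃ δ : ℝ, 0 < δ ∧ δ < 1 / 2 ∧ ∀ c : ℕ, ∀ᶠ m : ℕ in atTop, ∀ C : Literature.Computability.Complexity.Circuit ((⊤ : SimpleGraph (Fin m)).edgeSet), C.IsOver Literature.Computability.Complexity.B2 → C.size ≤ m ^ c → ¬ C.Computes (fun x => decide (¬ (SimpleGraph.fromEdgeSet {e : Sym2 (Fin m) | ∃ h : e ∈ (⊤ : SimpleGraph (Fin m)).edgeSet, x ⟨e, h⟩ = true}).CliqueFree ⌈(m : ℝ) ^ δ⌉₊))) → PneNP := by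
  rintro ⟨δ, _hδ0, hδ, hLB⟩
  by_contra hne
  obtain ⟨c₁, hc₁⟩ := exists_circuit_cliqueFn_of_NP_subset_PPoly (NP_subset_PPoly_of_not_pneNP hne)
  obtain ⟨m, hm, hcirc, hm1⟩ := ((hLB c₁).and (hc₁.and (eventually_ge_atTop 1))).exists
  have hk : ⌈(m : ℝ) ^ δ⌉₊ ≤ m := by
    refine Nat.ceil_le.2 ?_
    calc (m : ℝ) ^ δ ≤ (m : ℝ) ^ (1 : ℝ) :=
          Real.rpow_le_rpow_of_exponent_le (by exact_mod_cast hm1) (by linarith)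
      _ = m := Real.rpow_one _
  obtain ⟨C, hB, hs, hC⟩ := hcirc _ hk
  exact hm C hB hs hC

end Bridge

end Summit.PneNP.PneNP.Theorems
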